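import Summits.CriticalPhenomena.PercolationContinuityZ3.Theorems.Transplant.SkelFrmFromBParamsLO
import Summits.CriticalPhenomena.PercolationContinuityZ3.Theorems.Transplant.SkelFrmBParamsLO
import Summits.CriticalPhenomena.PercolationContinuityZ3.Theorems.Transplant.SkelNegBParamsLO
import Summits.CriticalPhenomena.PercolationContinuityZ3.Theorems.Transplant.SkelNegBParamsB
import Summits.CriticalPhenomena.PercolationContinuityZ3.Theorems.Transplant.PlanarSkeletonFrmFromDefs
import Summits.CriticalPhenomena.PercolationContinuityZ3.Theorems.Transplant.PlanarSkeletonFrmDefs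
import Summits.CriticalPhenomena.PercolationContinuityZ3.Theorems.Transplant.SkelPhiStepIDataNS
import HarnessLib
import Summits.CriticalPhenomena.PercolationContinuityZ3.Theorems.Transplant.SkelFrmBParamsB
/-!
# U-WAVE PORT (RULING D-U, lead g21 2026-08-26; WAVE-U-MANIFEST v3.0 row «SkelFrmBParamsB» ↦ «SkelFrmFromBParamsB») of the tree module
# `Transplant/SkelFrmBParamsB` onto the carrier `PlanarSkeletonFrmFrom` (frames only, cylinders connected from width `ℓ₀` on)

ORIGINAL TITLE: N2 (frames-only node `SamePDropOfSkeletonFrm₁`, OPEN) params column over `PlanarSkeletonFrm` — (ζ″) ledger, shape (B′) of record ((R-14)):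

builds on p205010 (kernel theorem, internal audit signed; external expert review pending) — nothing in this file uses p205010; NOTHING is claimed about the
OPEN node U `SamePDropOfSkeletonFrmFrom₁` (nor U_s / the end state).  Lane `prim-bschramm`, seat `prim-bschramm-p3` gen 26; helper file
(`--supports stmt-CriticalPhenomena-4575 --as helper`).  PORT RULES r1–r4 of RULING D-U: declaration order and proof texts are those of the original,
byte-identical except (i) the carrier token `PlanarSkeletonFrm ↦ PlanarSkeletonFrmFrom` (binders, `namespace`/`end` lines, qualified names of twinned
declarations), (ii) carrier-FREE declarations of the original (φ-level `Skelφ…` blocks and namespace-only arithmetic residents) are NOT re-declared —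
this file imports the original and `export`s the twin-free residents (POLICY T / treatment (m1)); residents whose statement mentions a twinned
constant are copied, (iii) every carrier-binding declaration keeps its explicit binder `(Φ : PlanarSkeletonFrmFrom G)` in its own signature (r2).  Docstrings and citations are the original's.
-/

noncomputable section

open scoped Classical

namespace Summit.CriticalPhenomena.PercolationContinuityZ3.Theorems.Transplant

namespace PlanarSkeletonFrmFrom

namespace NegB

open Literature.Probability.Percolation Literature.Probability.LatticeModels SimpleGraph
open SkelConc (Consts)
open Skelφ (oriφ trφ)
open Skelφ.StepI (DataN)
open Neg

section Bridge

/-! ## §1 The bridge zone index, width and data -/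

/-- **The bridge zone index with floor slot `mb`**: `M_b := max M_u mb`. [this work] -/
def MB {V : Type} (D : Skelφ.StepI.DataNS V) (mb : ℕ) : ℕ := D.sM (max (Mu D) mb)

/-- **The bridge width with clearance slot `b`**: `n_b := max (n₁ M_b) (M_b + b + 2 + ρz)` (the landed `NegPrm.nS` at the bridge index with its `R′`-slot at `b`). [this work] -/
def nB {V : Type} (D : Skelφ.StepI.DataNS V) (mb b : ℕ) : ℕ := D.sN (max (Mu D) mb) (Skelφ.NegPrm.nS (D.n₁ (MB D mb)) (MB D mb) b (ρz D))

/-- The bridge shear `h_b := D.hgt t M_b n_b`. [this work] -/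
def hB {V : Type} (t : V) (D : Skelφ.StepI.DataNS V) (mb b : ℕ) : ℤ := D.hgt t (MB D mb) (nB D mb b)

/-- The bridge half-length `ℓ_b := D.len t M_b n_b`. [this work] -/
def ℓB {V : Type} (t : V) (D : Skelφ.StepI.DataNS V) (mb b : ℕ) : ℕ := D.len t (MB D mb) (nB D mb b)

/-- The bridge split point `v_b := D.spl t M_b n_b`. [this work] -/
def vB {V : Type} (t : V) (D : Skelφ.StepI.DataNS V) (mb b : ℕ) : ℤ := D.spl t (MB D mb) (nB D mb b)

/-- `M_u ≤ M_b`, `mb ≤ M_b`, `D.M₀ ≤ M_b`. [folklore] -/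
theorem MB_facts {V : Type} (D : Skelφ.StepI.DataNS V) (mb : ℕ) : Mu D ≤ MB D mb ∧ mb ≤ MB D mb ∧ D.M₀ ≤ MB D mb :=
  ⟨(le_max_left _ _).trans (D.le_sM _), (le_max_right _ _).trans (D.le_sM _), (M₀_le_Mu D).trans ((le_max_left _ _).trans (D.le_sM _))⟩

/-- **The bridge width's facts**: `n₁ M_b ≤ n_b`, `M_b < n_b`, `b ≤ n_b`, `M_b + b + 2 + ρz ≤ n_b` — for EVERY `b`, in particular `b := Δ₀` read after the kit block. [folklore] -/
theorem nB_facts {V : Type} (D : Skelφ.StepI.DataNS V) (mb : ℕ) (b : ℕ) : D.n₁ (MB D mb) ≤ nB D mb b ∧ MB D mb < nB D mb b ∧ b ≤ nB D mb b ∧ MB D mb + b + 2 + ρz D ≤ nB D mb b :=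
  ⟨(Skelφ.NegPrm.n₁_le_nS _ _ _ _).trans (D.le_sN _ _), (Skelφ.NegPrm.Mu_lt_nS _ _ _ _).trans_le (D.le_sN _ _),
    (Skelφ.NegPrm.R'_le_nS _ _ _ _).1.trans (D.le_sN _ _), (Skelφ.NegPrm.floor_le_nS _ _ _ _).trans (D.le_sN _ _)⟩

/-- **The bridge pair IS the selected pair** at zone floor `max M_u mb` and width floor `NegPrm.nS (n₁ M_b) M_b b ρz` (by `rfl`; joint selection: `D.sN`'s first
argument is the literal handed to `D.sM`). [folklore] -/
theorem bridge_pair_eq {V : Type} (D : Skelφ.StepI.DataNS V) (mb : ℕ) (b : ℕ) :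
    MB D mb = D.sM (max (Mu D) mb) ∧ nB D mb b = D.sN (max (Mu D) mb) (Skelφ.NegPrm.nS (D.n₁ (MB D mb)) (MB D mb) b (ρz D)) := ⟨rfl, rfl⟩

/-- **The bridge pair is admissible** (`D.M₀ ≤ M_b`, `D.n₁ M_b ≤ n_b`) — the certificate the pair slot `Pv` carries. [folklore] -/
theorem bridge_adm {V : Type} (D : Skelφ.StepI.DataNS V) (mb : ℕ) (b : ℕ) : D.M₀ ≤ (MB D mb, nB D mb b).1 ∧ D.n₁ (MB D mb, nB D mb b).1 ≤ (MB D mb, nB D mb b).2 :=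
  ⟨(MB_facts D mb).2.2, (nB_facts D mb b).1⟩

/-- **(R-F2) at the ledger's names** (exact floor, p3-g9 2026-08-21T15:55:22Z): with `b := Δ₀ := D.k + 2R′ + 1`, `Δ₀ ≤ n_b`. [folklore] -/
theorem RF2_at {V : Type} [DecidableEq V] [Countable V] {G : SimpleGraph V} [G.LocallyFinite] (Φ : PlanarSkeletonFrmFrom G) (t : V) (D : Skelφ.StepI.DataNS V) (mb : ℕ) (κ : Consts) (p : unitInterval) : D.k + 2 * R' κ Φ t p D + 1 ≤ nB D mb (D.k + 2 * R' κ Φ t p D + 1) :=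
  (nB_facts D mb _).2.2.1

/-- **The one-stride floor through `mb`**: with `mb := max (2Δ₀ + 26) (22·M_u + 58)`, `2Δ₀ + 26 ≤ M_b` and `22·M_u + 58 ≤ M_b`. [folklore] -/
theorem MB_floors {V : Type} [DecidableEq V] [Countable V] {G : SimpleGraph V} [G.LocallyFinite] (Φ : PlanarSkeletonFrmFrom G) (t : V) (D : Skelφ.StepI.DataNS V) (κ : Consts) (p : unitInterval) :
    2 * (D.k + 2 * R' κ Φ t p D + 1) + 26 ≤ MB D (max (2 * (D.k + 2 * R' κ Φ t p D + 1) + 26) (22 * Mu D + 58)) ∧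
      22 * Mu D + 58 ≤ MB D (max (2 * (D.k + 2 * R' κ Φ t p D + 1) + 26) (22 * Mu D + 58)) :=
  ⟨(le_max_left _ _).trans (MB_facts D _).2.1, (le_max_right _ _).trans (MB_facts D _).2.1⟩

/-! ## §2 The oriented bridge bit and map, the clause from `FactsO` -/

/-- **The bridge pair's orientation bit** `o_b := ori t M_b n_b` (values at the merged record). [this work] -/
def oB {V : Type} (t : V) (D : Skelφ.StepI.DataNS V) (DT : DataN V) (ori : V → ℕ → ℕ → Bool) (mb : ℕ) (b : ℕ) : Bool := ori t (MB (D.orient DT ori) mb) (nB (D.orient DT ori) mb b)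

/-- **The planar map the BRIDGE STEP reads**: `Φ.φ` or its transpose. [this work] -/
def φB {V : Type} {G : SimpleGraph V} [G.LocallyFinite] (Φ : PlanarSkeletonFrmFrom G) (t : V) (D : Skelφ.StepI.DataNS V) (DT : DataN V) (ori : V → ℕ → ℕ → Bool) (mb : ℕ) (b : ℕ) : V → Site 2 := oriφ Φ.φ (oB t D DT ori mb b)

/-- `φB` is 1-Lipschitz. [folklore] -/
theorem lip_φB {V : Type} {G : SimpleGraph V} [G.LocallyFinite] (Φ : PlanarSkeletonFrmFrom G) (t : V) (D : Skelφ.StepI.DataNS V) (DT : DataN V) (ori : V → ℕ → ℕ → Bool) (mb : ℕ) (b : ℕ) : Skelφ.Lip G (φB Φ t D DT ori mb b) := Skelφ.lip_oriφ Φ.lip _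

/-- `φB` has unit steps. [folklore] -/
theorem steps_φB {V : Type} {G : SimpleGraph V} [G.LocallyFinite] (Φ : PlanarSkeletonFrmFrom G) (t : V) (D : Skelφ.StepI.DataNS V) (DT : DataN V) (ori : V → ℕ → ℕ → Bool) (mb : ℕ) (b : ℕ) : Skelφ.Steps G (φB Φ t D DT ori mb b) := Skelφ.steps_oriφ Φ.step _

/-- **THE BRIDGE CLAUSE FROM `FactsO`**: the merged record's geometric clause at `(M_b, n_b)` FOR THE ORIENTED MAP `φB`, and `|h_b| ≤ 10·n_b`. [this work] -/
theorem clauseB_of_factsO {V : Type} {G : SimpleGraph V} [G.LocallyFinite] (Φ : PlanarSkeletonFrmFrom G) (t : V) (D : Skelφ.StepI.DataNS V) (DT : DataN V) (ori : V → ℕ → ℕ → Bool) (mb : ℕ) (b : ℕ) (hR : DT.R = D.R)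
    (hfacts : ∀ M, D.M₀ ≤ M → ∀ n, D.n₁ M ≤ n →
      (ori t M n = true → D.EqGeom G Φ.φ t M n ∧ (D.hgt t M n).natAbs ≤ 10 * n) ∧
      (ori t M n = false → DT.EqGeom G (trφ Φ.φ) t M n ∧ (DT.hgt t M n).natAbs ≤ 10 * n)) :
    (D.orient DT ori).EqGeom G (φB Φ t D DT ori mb b) t (MB (D.orient DT ori) mb) (nB (D.orient DT ori) mb b) ∧
      (hB t (D.orient DT ori) mb b).natAbs ≤ 10 * nB (D.orient DT ori) mb b :=
  Skelφ.StepI.orient_clause_all hR hfacts _ (MB_facts _ mb).2.2 _ (nB_facts _ mb b).1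

/-- **The bridge pair's geometric facts unpacked** (ℤ shapes), for ANY map. [folklore] -/
theorem eqNumB_of_eqGeom {V : Type} {G : SimpleGraph V} [G.LocallyFinite] (t : V) (D : Skelφ.StepI.DataNS V) (mb : ℕ) (b : ℕ) (ψ : V → Site 2) (hE : D.EqGeom G ψ t (MB D mb) (nB D mb b)) :
    MB D mb < nB D mb b ∧ MB D mb < ℓB t D mb b ∧ |vB t D mb b| ≤ (nB D mb b : ℤ) ∧
      ((MB D mb : ℤ) + 1) * ((nB D mb b : ℤ) + |hB t D mb b|) ≤ (nB D mb b : ℤ) * ((ℓB t D mb b : ℤ) + 1) :=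
  eqGeom_num_of t D ψ hE

/-- **The one-stride room**: `mb + 1 ≤ ℓ_b` (from `M_b < ℓ_b`; with `mb ≥ 2Δ₀ + 26` this is `ℓ_b ≥ 2Δ₀ + 27 ≥ 2Δ₀ + 25`, p3-g9 15:55:22Z / p5-g8 15:52:09Z). [folklore] -/
theorem ℓB_ge {V : Type} {G : SimpleGraph V} [G.LocallyFinite] (t : V) (D : Skelφ.StepI.DataNS V) (mb : ℕ) (b : ℕ) (ψ : V → Site 2) (hE : D.EqGeom G ψ t (MB D mb) (nB D mb b)) : mb + 1 ≤ ℓB t D mb b :=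
  (Nat.succ_le_of_lt (lt_of_le_of_lt (MB_facts D mb).2.1 (eqNumB_of_eqGeom t D mb b ψ hE).2.1))

end Bridge

end NegB

end PlanarSkeletonFrmFrom

end Summit.CriticalPhenomena.PercolationContinuityZ3.Theorems.Transplant

end
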